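import Summits.BirchSwinnertonDyer.BirchSwinnertonDyer.Theses.AdditiveKolyvaginRoad
import Summits.BirchSwinnertonDyer.Rank1Residual.X11b.BDPRouteOnTreeStepL
import Literature.NumberTheory.EllipticCurves.BSDQuotientOverNumberField
import HarnessLib

/-!
# Sketch — crux idea `parahoric-ordinary-type-engine` (crux-ideate seat 1, round 1, g13) on
`LevelKolyvaginSystemsAdditive` (stmt-BirchSwinnertonDyer-21396)

First-lemma typing only (CRUX PROTOCOL: no skeleton at this stage). Every `def` is a `Prop`
(nothing asserted); the two `theorem`s are one-line glue, no `sorry`. BSD is not proved by this;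
KS′ is neither proved nor refuted by this.

The ENGINE (card §Lever): Wan's partially-ordinary `U(3,1)` Klingen–Eisenstein congruence method
(arXiv:1412.1767 §3–5, arXiv:1411.6352 Thm 2.13) with the `GL₂`-block of the Levi carried at the
`P`-Iwahori level `I_{P,1}` with the depth-zero Bushnell–Kutzko type `τ_θ` of `π_{f,p}` as
`P`-nebentypus (Marcil arXiv:2310.09110, arXiv:2409.03783), run over an AUXILIARY imaginary quadratic
field whose non-split primes are among the ♯ frame's multiplicative primes `ℓ₁, ℓ₂`.
-/

open scoped Classical

open WeierstrassCurve NumberField IsDedekindDomain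
  Literature.NumberTheory.EllipticCurves Literature.NumberTheory.EllipticCurves.ModularForms
  Literature.NumberTheory.EllipticCurves.Rank1Residual
  Summit.BirchSwinnertonDyer.Rank1Residual.X11b
  Summit.BirchSwinnertonDyer.Rank1Residual.X11b.AcSelmer

namespace Summit.BirchSwinnertonDyer.BirchSwinnertonDyer.Cruxes.LevelKolyvaginSystemsAdditive.ParahoricOrdinaryTypeEngine

section OnTree

variable (W : WeierstrassCurve ℚ) [W.IsElliptic] [W.IsGloballyMinimal] {K : Type} [Field K]
  [NumberField K]
variable (p : ℕ) [Fact p.Prime] (κ : ZpExtension K p) (𝔭 : HeightOneSpectrum (𝓞 K))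
  (γ : Field.absoluteGaloisGroup K) [Fact (κ.IsTopGenerator γ)] (ι : K →+* ℚ_[p])

/-- **(C2)ᵃᵈᵈ @ 𝟙 — THE ENGINE'S OUTPUT in X11b vocabulary.** The Greenberg ("Eisenstein",
lower-bound-on-Ш) divisibility `Ch_Λ(X_(∅,0)(E/K_∞)) ⊆ (ℒ^{Gr}_{f,K}|_{ac})` read at the trivial
character: the constructed `X_ac = XAc (E_K) p κ 𝔭 ∅ γ` is `Λ`-torsion with a generator `f`,
`f(0) ≠ 0`, `ord_p f(0) = n`, and `lp ≤ n`, where `lp` is the (unconstructed, shadow-style) order at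
`𝟙` of the CM-period-normalised Greenberg/BDP `p`-adic `L`-function. A predicate. -/
def GreenbergLowerAtOne (lp : ℤ) : Prop :=
  ∃ n : ℕ, XAc.HasCharValuationAt (W.baseChange K) p κ 𝔭 ∅ γ n ∧ lp ≤ (n : ℤ)

/-- **(C1)ᵃᵈᵈ @ 𝟙 — the additive `p`-adic Waldspurger VALUE clause** (Liu–Zhang–Zhang 2018 Thm
1.5.3 shape at an additive split `p`: `a_p = 0`, Euler factor at `p` trivial, so NO `−1` shift as in
X11b's multiplicative `IMCLowerWaldspurgerOnTreeAt`; `p ∤ c_Manin·u_K` carried by the ♯ frame):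
`lp = 2·ord_p log_ω P`. Owned by the sister line `bdp-rebase` (C1); typed here only to show the
composition. A predicate. -/
def WaldspurgerAtOneAdditive (lp : ℤ) (P : (W.baseChange K).toAffine.Point) : Prop :=
  lp = 2 * padicLogOrd W p ι P

/-- **(IMC ⊇ ∘ pW)ᵃᵈᵈ at the point `P`** — the additive analogue of X11b's open link
`IMCLowerWaldspurgerOnTreeAt` (no `−1`): what `Lines/bdp_rebase.lean` S5 (engine E2) consumes
together with additive control (C3). A predicate; NEVER a theorem here. -/
def IMCLowerWaldspurgerOnTreeAdditiveAt (P : (W.baseChange K).toAffine.Point) : Prop :=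
  ∃ n : ℕ, XAc.HasCharValuationAt (W.baseChange K) p κ 𝔭 ∅ γ n ∧ 2 * padicLogOrd W p ι P ≤ (n : ℤ)

variable {W p κ 𝔭 γ ι}

/-- Composition: ENGINE (C2)ᵃᵈᵈ + value clause (C1)ᵃᵈᵈ give the additive on-tree link. [folklore] -/
theorem imcLowerWaldspurgerOnTreeAdditiveAt_of_parts {lp : ℤ} {P : (W.baseChange K).toAffine.Point}
    (h2 : GreenbergLowerAtOne W p κ 𝔭 γ lp) (h1 : WaldspurgerAtOneAdditive W p ι lp P) :
    IMCLowerWaldspurgerOnTreeAdditiveAt W p κ 𝔭 γ ι P := by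
  obtain ⟨n, hn, hle⟩ := h2
  refine ⟨n, hn, ?_⟩
  rw [← h1]
  exact hle

end OnTree

section OverQ

/-- **One-sided `p`-part of BSD over a number field ("Eisenstein direction": Ш is at least as large
as predicted)**: `Ш(E/F)[p^∞]` finite, `#Ш_an` rational, `ord_p #Ш_an ≤ ord_p #Ш(E/F)[p^∞]`
(Miller's `BSD(E,p)` with `=` weakened to `≤`; tree `BSDpOver` is the two-sided version). -/
def BSDpLowerOver {F : Type*} [Field F] [NumberField F] (V : WeierstrassCurve F) (p : ℕ) : Prop :=
  Finite (AddCommGroup.primaryComponent V.sha p) ∧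
    ∃ q : ℚ, analyticSha V = (q : ℂ) ∧
      padicValRat p q ≤ padicValNat p (Nat.card (AddCommGroup.primaryComponent V.sha p))

/-- The two-sided `p`-part gives the one-sided one. [folklore] -/
theorem bsdpLowerOver_of_bsdpOver {F : Type*} [Field F] [NumberField F] (V : WeierstrassCurve F)
    (p : ℕ) (h : BSDpOver V p) : BSDpLowerOver V p := by
  obtain ⟨hfin, q, hq, hval⟩ := h
  exact ⟨hfin, q, hq, le_of_eq hval⟩

/-- **FIRST LEMMA of the line (rank-0 pair deliverable; Wan arXiv:1411.6352 Cor 4.8 shape at a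
TAME SUPERCUSPIDAL `p`).** For `E₀/ℚ` additive potentially supersingular at `p ≥ 5` with
`ρ̄_{E₀,p}` onto, and an auxiliary imaginary quadratic `K″` with `p` split, odd `d_{K″}` prime to
`N`, exactly... (at least) one multiplicative prime `ℓ` of `E₀` INERT in `K″` with `E₀[p]` ramified
at `ℓ` (the definite `U(2)` carrier `D_{ℓ,∞}`), and `r_an(E₀/K″) = 0`: the `P_{2,1,1}`-ordinary
`U(3,1)` Eisenstein congruence at type level `(I_{P,1}, τ_θ)` over `K″`, specialised at `𝟙` (a
non-interpolation point, as in Wan's Thm 1.1(2)) plus Greenberg-Selmer control at `𝟙`, gives the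
ONE-SIDED `p`-part of BSD for `E₀/K″`: `ord_p #Ш_an(E₀/K″) ≤ ord_p #Ш(E₀/K″)[p^∞]`. Neither a
`p`-adic Waldspurger formula nor Heegner points enter. OPEN (research: the type-level family);
stated as a `Prop`. -/
def EngineRankZeroPairDeliverable : Prop :=
  ∀ (W₀ : WeierstrassCurve ℚ) [W₀.IsElliptic] [W₀.IsGloballyMinimal] (p : ℕ) [Fact p.Prime]
    (K'' : Type) [Field K''] [NumberField K''],
    5 ≤ p → Addv W₀ p → W₀.HasSurjectiveModNGaloisRep p →
    IsImaginaryQuadratic K'' → Odd (NumberField.discr K'') →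
    IsCoprime (NumberField.discr K'') (W₀.conductorNorm ℤ : ℤ) →
    jacobiSym (NumberField.discr K'') p = 1 →
    (∃ (ℓ : ℕ) (_ : Fact ℓ.Prime), W₀.HasMultiplicativeReductionAtPrime ℓ ∧
      jacobiSym (NumberField.discr K'') ℓ = -1 ∧ ¬ p ∣ padicValInt ℓ W₀.minimalDiscriminantInt) →
    ¬ p ∣ W₀.tamagawaProduct →
    W₀.entireLFunction 1 ≠ 0 →
    (W₀.quadraticTwist (NumberField.discr K'' : ℚ)).entireLFunction 1 ≠ 0 →
    BSDpLowerOver (W₀.baseChange K'') p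

/-- **SOCKET (support, near-tree bookkeeping): two one-sided `p`-parts over `ℚ` give the
Heegner-index lower bound over the ♯ frame's own Heegner field** (Gross–Zagier on `X₀(N)` +
`Ш(E/K)[p^∞] = Ш(E)[p^∞] ⊕ Ш(E^{(d_K)})[p^∞]` + Artin formalism for the leading terms, `p ∤
c_Manin·#tors·∏c_ℓ·u_K`): this is how an engine that only runs over AUXILIARY generalized-Heegner
fields (W2: no definite-unitary carrier at `N⁻ = 1`) still feeds `bdp_rebase` S5 /
`X11b.IndexLowerBoundAt` on the frame. A predicate (glue target, M-sized). -/
def SocketOverQ : Prop :=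
  ∀ (W : WeierstrassCurve ℚ) [W.IsElliptic] [W.IsGloballyMinimal] [NeZero (W.conductorNorm ℤ)]
    (p : ℕ) [Fact p.Prime] (K : Type) [Field K] [NumberField K]
    (Dt : ModularParametrizationData W (W.conductorNorm ℤ)) (β : ℤ) (ι : K →+* ℂ),
    5 ≤ p → W.HasSurjectiveModNGaloisRep p → ¬ p ∣ W.tamagawaProduct → W.analyticRank = 1 →
    IsImaginaryQuadratic K → Odd (NumberField.discr K) → NumberField.discr K < -4 →
    SatisfiesHeegnerHypothesis (W.conductorNorm ℤ) K →
    (W.quadraticTwist (NumberField.discr K : ℚ)).entireLFunction 1 ≠ 0 →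
    (4 * (W.conductorNorm ℤ : ℤ)) ∣ β ^ 2 - NumberField.discr K → ¬ (p : ℤ) ∣ Dt.c →
    BSDpLowerOver W p → BSDpLowerOver (W.quadraticTwist (NumberField.discr K : ℚ)) p →
    ∀ (H : HeegnerDatum (W.conductorNorm ℤ) (NumberField.discr K)) (P : (W.baseChange K).toAffine.Point),
      H.β = β → WeierstrassCurve.Affine.Point.map ι.toRatAlgHom P = heegnerPointComplex Dt H →
      ¬ IsOfFinAddOrder P → IndexLowerBoundAt W p K P

end OverQ

end Summit.BirchSwinnertonDyer.BirchSwinnertonDyer.Cruxes.LevelKolyvaginSystemsAdditive.ParahoricOrdinaryTypeEngine
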